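import Summits.AtomisticToContinuum.Crystallization.Theorems.ChargedEnergyGapChartDialZH
import Summits.AtomisticToContinuum.Crystallization.Theorems.ChargedEnergyGapChartDialZC
import Summits.AtomisticToContinuum.Crystallization.Theorems.ChargedEnergyGapChartDialZF

/-!
# `ChargedEnergyGap` · the CHART DIAL, part ZJ: THE LABELLED LEAF, THE TUBE SPLIT, AND HYPOTHESIS 3 FROM TWO LEAVES
(decomp-a2c lens-3 g40 node «SphericalDozen», second file; first file = part ZH)

Part ZH translated [C] `GraphedDozenClose θ p` (part Q) to windowed spherical codes:
`SphericalGraphedClose θ₁ p → GraphedDozenClose θ p` for unit tuples `p` and `101/100 · θ₁² + 1/10000 ≤ θ²`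
(at the dial `θ = 3/20`: `θ₁ = 37/250`).  This part finishes the node.

§1 THE LABELLED LEAF.  `LabelledWindowedClose η p`: every tuple of twelve unit vectors `u` with all pairwise cosines
   `≤ 5201/10201` and cosine `≥ 9799/20000` on every pair `k ≠ l` with `dist (p k) (p l) = 1` — a LABELLED windowed
   realisation of the unit-distance graph of `p`, no relabelling, no abstract graph — is `η`-`TupleClose` to `p`.
   `sphericalGraphedClose_of_labelled : LabelledWindowedClose η p → SphericalGraphedClose η p` (relabel by the `σ` of
   `TupleIso`, `TupleClose.of_comp_perm`), and conversely `labelledWindowedClose_of_spherical` for every `p` whose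
   unit-distance graph is `4`-regular.  This is the shape of the metric half of crux `ShellTrichotomy` (gapped regime,
   `Cruxes/ShellTrichotomy/Lines/Sketch.lean`: `stub_fccClose` / `stub_hcpClose`, windows `1/50`, far gap `63/50`, `η = 1/5`)
   transported to the scale-free regime: windows `1 %`, NO far gap (non-bonds only `≥ 100/101`), radii exactly `1`, `η = 37/250`;
   it is the input shape of the certificate kernel `Literature.Geometry.DiscreteGeometry.ShellQuadCert`
   (`ShellSpec` with `rlo = gap = 100/101`, `rhi = 101/100`, `tupleClose_of_hyp`; the instantiation is part ZK).
§2 THE TUBE SPLIT (exact AND-node, both pieces kernel-weaker).  `LabelledLocalRigidity ρ₀ θ₁ p`: a labelled windowed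
   realisation that is already `ρ₀`-close is `θ₁`-close.  Seam `labelledWindowedClose_of_capture_rigidity :
   LabelledWindowedClose ρ₀ p → LabelledLocalRigidity ρ₀ θ₁ p → LabelledWindowedClose θ₁ p`; necessity of both pieces
   (`capture_of_labelledWindowedClose` for `θ₁ ≤ ρ₀`, `localRigidity_of_labelledWindowedClose`), hence
   `labelledWindowedClose_iff_capture_rigidity`.  COARSE CAPTURE at `ρ₀` (e.g. `3/10`) is the global / combinatorial piece
   (area budget of the `8` triangles and `6` quadrilaterals of either contact graph, trilateration in graph order,
   or a coarse `QuadCert` certificate: part ZK); LOCAL RIGIDITY `ρ₀ → θ₁` is the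
   second-order analysis along the unique flex of the spherical contact framework (fcc: jitterbug, reach `0·1004` at the
   `1 %` window; hcp: bicupola counter-twist, reach `0·1339`; both `< 37/250 = 0·148`; numerics in the node memo).
§3 HYPOTHESIS 3 FROM TWO LEAVES.  With [G] (part ZC) and [A] (part ZF, `noAntiprismDozen_holds`) in the tree:
   `twelveShellShaped_of_graphedClose`, `twelveShellShaped_of_labelled :
   LabelledWindowedClose (37/250) fccTuple → LabelledWindowedClose (37/250) hcpTuple → TwelveShellShaped (3/20)`,
   `chargeFreeShaped_of_labelled`, the four-leaf form `twelveShellShaped_of_capture_rigidity` (`ρ₀ = 3/10`), and the P line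
   `chartedChargePricing_of_far_cleanApproachHarnack_labelled` at `(θ, R, M₀, M₁) = (3/20, 3, 4, 80)`.

No `sorry`, no new axiom, no instance / notation / option.
-/

noncomputable section

open scoped RealInnerProductSpace
open Literature.MathematicalPhysics.StatisticalMechanics
open Literature.Geometry.DiscreteGeometry
open Literature.Geometry.DiscreteGeometry.ShellCensus
open Summit.AtomisticToContinuum.Crystallization.Theses.PricedLinkCensus
open Summit.AtomisticToContinuum.Crystallization.Theorems.ChargedEnergyGapNegative

namespace Summit.AtomisticToContinuum.Crystallization.Theorems.ChargedEnergyGapChartDial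

/-! ## §1 The labelled leaf -/

/-- A **labelled windowed realisation** of the unit-distance graph of `p`: unit vectors, every two distinct directions at
cosine `≤ 5201/10201`, and cosine `≥ 9799/20000` on every pair at pattern distance `1`. -/
def IsLabelledWindowed (u p : Fin 12 → E3) : Prop :=
  (∀ k, ‖u k‖ = 1) ∧ (∀ k l, k ≠ l → ⟪u k, u l⟫ ≤ 5201 / 10201) ∧
    (∀ k l, k ≠ l → dist (p k) (p l) = 1 → (9799 : ℝ) / 20000 ≤ ⟪u k, u l⟫)

/-- **The labelled leaf** `LabelledWindowedClose η p`: every labelled windowed realisation of the unit-distance graph of `p`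
is `η`-`TupleClose` to `p`. -/
def LabelledWindowedClose (η : ℝ) (p : Fin 12 → E3) : Prop :=
  ∀ u : Fin 12 → E3, IsLabelledWindowed u p → TupleClose η u p

/-- Tuple closeness is monotone in the tolerance. -/
theorem tupleClose_weaken {n : ℕ} {η η' : ℝ} {t p : Fin n → E3} (hle : η ≤ η') (h : TupleClose η t p) :
    TupleClose η' t p := by
  obtain ⟨A, σ, hA⟩ := h
  exact ⟨A, σ, fun k => (hA k).trans hle⟩

/-- **Labelled ⟹ spherical.**  Relabel the windowed code by the `σ` of `TupleIso`: `u ∘ σ` is a labelled windowed realisation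
of the unit-distance graph of `p`. -/
theorem sphericalGraphedClose_of_labelled {η : ℝ} {p : Fin 12 → E3} (h : LabelledWindowedClose η p) :
    SphericalGraphedClose η p := by
  intro u b hW σ hiso
  refine TupleClose.of_comp_perm σ (h (u ∘ σ) ⟨fun k => hW.1 (σ k), fun k l hkl => hW.2.1 _ _ (σ.injective.ne hkl),
    fun k l hkl hd => hW.2.2.1 _ _ ((hiso k l hkl).2 hd)⟩)

/-- **Spherical ⟹ labelled** for a tuple whose unit-distance graph is `4`-regular (take `b :=` that graph and `σ := 1`). -/
theorem labelledWindowedClose_of_spherical {η : ℝ} {p : Fin 12 → E3}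
    (hp4 : ∀ k, {l : Fin 12 | k ≠ l ∧ dist (p k) (p l) = 1}.ncard = 4) (h : SphericalGraphedClose η p) :
    LabelledWindowedClose η p := by
  intro u hu
  refine h u (fun k l => k ≠ l ∧ dist (p k) (p l) = 1)
    ⟨hu.1, hu.2.1, fun k l hb => hu.2.2 k l hb.1 hb.2, fun k l hb => ⟨fun e => hb.1 e.symm, by rw [dist_comm]; exact hb.2⟩,
      fun k hb => hb.1 rfl, hp4⟩ 1 (fun v w hvw => ?_)
  simp [hvw]

/-! ## §2 The tube split: coarse capture and local rigidity -/

/-- **[Rig] local rigidity** `LabelledLocalRigidity ρ₀ θ₁ p`: a labelled windowed realisation of the unit-distance graph of `p`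
that is `ρ₀`-`TupleClose` to `p` is `θ₁`-`TupleClose` to `p`. -/
def LabelledLocalRigidity (ρ₀ θ₁ : ℝ) (p : Fin 12 → E3) : Prop :=
  ∀ u : Fin 12 → E3, IsLabelledWindowed u p → TupleClose ρ₀ u p → TupleClose θ₁ u p

/-- **Seam**: coarse capture at `ρ₀` and local rigidity `ρ₀ → θ₁` give the labelled leaf at `θ₁`. -/
theorem labelledWindowedClose_of_capture_rigidity {ρ₀ θ₁ : ℝ} {p : Fin 12 → E3} (hC : LabelledWindowedClose ρ₀ p)
    (hR : LabelledLocalRigidity ρ₀ θ₁ p) : LabelledWindowedClose θ₁ p :=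
  fun u hu => hR u hu (hC u hu)

/-- **Necessity of [Cap]**: the leaf at `θ₁` gives coarse capture at every `ρ₀ ≥ θ₁`. -/
theorem capture_of_labelledWindowedClose {ρ₀ θ₁ : ℝ} {p : Fin 12 → E3} (hle : θ₁ ≤ ρ₀)
    (h : LabelledWindowedClose θ₁ p) : LabelledWindowedClose ρ₀ p :=
  fun u hu => tupleClose_weaken hle (h u hu)

/-- **Necessity of [Rig]**: the leaf at `θ₁` gives local rigidity from every `ρ₀`. -/
theorem localRigidity_of_labelledWindowedClose {ρ₀ θ₁ : ℝ} {p : Fin 12 → E3} (h : LabelledWindowedClose θ₁ p) :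
    LabelledLocalRigidity ρ₀ θ₁ p :=
  fun u hu _ => h u hu

/-- **The split is exact**: for `θ₁ ≤ ρ₀`, `LabelledWindowedClose θ₁ p ↔ LabelledWindowedClose ρ₀ p ∧ LabelledLocalRigidity ρ₀ θ₁ p`. -/
theorem labelledWindowedClose_iff_capture_rigidity {ρ₀ θ₁ : ℝ} {p : Fin 12 → E3} (hle : θ₁ ≤ ρ₀) :
    LabelledWindowedClose θ₁ p ↔ LabelledWindowedClose ρ₀ p ∧ LabelledLocalRigidity ρ₀ θ₁ p :=
  ⟨fun h => ⟨capture_of_labelledWindowedClose hle h, localRigidity_of_labelledWindowedClose h⟩,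
    fun h => labelledWindowedClose_of_capture_rigidity h.1 h.2⟩

/-- Local rigidity from a smaller tube is the weaker claim. -/
theorem labelledLocalRigidity_of_le {ρ₀ ρ₁ θ₁ : ℝ} {p : Fin 12 → E3} (hle : ρ₁ ≤ ρ₀) (h : LabelledLocalRigidity ρ₀ θ₁ p) :
    LabelledLocalRigidity ρ₁ θ₁ p :=
  fun u hu hc => h u hu (tupleClose_weaken hle hc)

/-- Local rigidity to a larger tolerance is the weaker claim. -/
theorem labelledLocalRigidity_weaken {ρ₀ θ₁ θ₂ : ℝ} {p : Fin 12 → E3} (hle : θ₁ ≤ θ₂) (h : LabelledLocalRigidity ρ₀ θ₁ p) :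
    LabelledLocalRigidity ρ₀ θ₂ p :=
  fun u hu hc => tupleClose_weaken hle (h u hu hc)

/-! ## §3 Hypothesis 3 from two leaves -/

/-- **The finite shape statement from [C] alone** ([G] part ZC, [A] part ZF discharged). -/
theorem twelveShellShaped_of_graphedClose {θ : ℝ} (h0 : GraphedDozenClose θ fccTuple) (h1 : GraphedDozenClose θ hcpTuple) :
    TwelveShellShaped θ :=
  twelveShellShaped_of_noAntiprism_graphedClose noAntiprismDozen_holds h0 h1

/-- **Hypothesis 3 at the dial from the two spherical leaves.** -/
theorem twelveShellShaped_of_spherical (h0 : SphericalGraphedClose (37 / 250) fccTuple)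
    (h1 : SphericalGraphedClose (37 / 250) hcpTuple) : TwelveShellShaped (3 / 20) :=
  twelveShellShaped_of_graphedClose (graphedDozenClose_fcc_of_spherical h0) (graphedDozenClose_hcp_of_spherical h1)

/-- ★ **Hypothesis 3 at the dial from the two LABELLED leaves**:
`LabelledWindowedClose (37/250) fccTuple → LabelledWindowedClose (37/250) hcpTuple → TwelveShellShaped (3/20)`. -/
theorem twelveShellShaped_of_labelled (h0 : LabelledWindowedClose (37 / 250) fccTuple)
    (h1 : LabelledWindowedClose (37 / 250) hcpTuple) : TwelveShellShaped (3 / 20) :=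
  twelveShellShaped_of_spherical (sphericalGraphedClose_of_labelled h0) (sphericalGraphedClose_of_labelled h1)

/-- `ChargeFreeShaped (3/20)` — hypothesis 3 of the P line verbatim — from the two labelled leaves. -/
theorem chargeFreeShaped_of_labelled (h0 : LabelledWindowedClose (37 / 250) fccTuple)
    (h1 : LabelledWindowedClose (37 / 250) hcpTuple) : ChargeFreeShaped (3 / 20) :=
  chargeFreeShaped_of_twelveShellShaped (twelveShellShaped_of_labelled h0 h1)

/-- **The four-leaf form** (tube split at `ρ₀ = 3/10` on both patterns). -/
theorem twelveShellShaped_of_capture_rigidity (c0 : LabelledWindowedClose (3 / 10) fccTuple)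
    (r0 : LabelledLocalRigidity (3 / 10) (37 / 250) fccTuple) (c1 : LabelledWindowedClose (3 / 10) hcpTuple)
    (r1 : LabelledLocalRigidity (3 / 10) (37 / 250) hcpTuple) : TwelveShellShaped (3 / 20) :=
  twelveShellShaped_of_labelled (labelledWindowedClose_of_capture_rigidity c0 r0)
    (labelledWindowedClose_of_capture_rigidity c1 r1)

/-- ★ **The P line at the dial of record through the labelled leaves**: far-field pricing at `(3/20, 3)` + clean-approach
Harnack at `(3/20, 3, 4, 80)` + the two labelled leaves ⇒ `ChartedChargePricing (3/20)`. -/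
theorem chartedChargePricing_of_far_cleanApproachHarnack_labelled (hFP : FarFieldPricing (3 / 20) 3)
    (hH : CleanApproachHarnack (3 / 20) 3 4 80) (h0 : LabelledWindowedClose (37 / 250) fccTuple)
    (h1 : LabelledWindowedClose (37 / 250) hcpTuple) : ChartedChargePricing (3 / 20) :=
  chartedChargePricing_of_far_cleanApproachHarnack_AC (by norm_num) (by norm_num) (by norm_num) hFP hH
    noAntiprismDozen_holds (graphedDozenClose_fcc_of_spherical (sphericalGraphedClose_of_labelled h0))
    (graphedDozenClose_hcp_of_spherical (sphericalGraphedClose_of_labelled h1))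

end Summit.AtomisticToContinuum.Crystallization.Theorems.ChargedEnergyGapChartDial

end
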